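import Literature.NumberTheory.PAdicHodge.TateAlmostEtaleRadicalDifferent
import Literature.NumberTheory.PAdicHodge.TateInvariantsBase

/-!
# Tate's almost étale lemma (TS1) — the package of `M(c^{1/ℓ})` for a prime `ℓ ≠ p` (radical ascent)

Assembly of the prime radical step (`TateAlmostEtaleRadicalDifferent`; cf. `TateAlmostEtaleRadicalStep`): for `K_∞ ⊆ M ⊆ F̄` with the
almost-perfectoid package, a prime `ℓ ≠ p` and `α^ℓ = c ∈ M^×`, the field `M(α)` has the package
((Γ) and (U_{min s 1 / 2})): `adjoin_primeRadical_package`. If `[M(α):M] < ℓ` then `c ∈ M^ℓ`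
(`N_{M(α)/M}(α)^ℓ = c^{[M(α):M]}` and Bezout), so `M(α) = M(ζ)` with `ζ^ℓ = 1` (`adjoin_rootOfUnity_package`);
if `[M(α):M] = ℓ`, rescale `c` by an `ℓ`-th power from `K_∞` into `‖p‖^δ ≤ ‖c‖ ≤ 1`
(`Kinf_exists_rescale`) and apply `radical_exists_norm_sub_pow_le`.
[cite: Tate1967, §3.2] [cite: Scholze2012, Lemma 3.2]
-/

noncomputable section

open Polynomial IntermediateField Module ValuativeRel Field

namespace Literature.NumberTheory.PAdicHodge

namespace TateAlmostEtale

open Literature.NumberTheory.GaloisRepresentations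
open Literature.NumberTheory.GaloisRepresentations.IsNonarchimedeanLocalField
open CyclotomicTower

variable {F : Type} [Field F] [ValuativeRel F] [TopologicalSpace F] [IsNonarchimedeanLocalField F]
  [CharZero F] {p : ℕ} [Fact p.Prime] (hp : valuation F p < 1)

/-! ### §1 Rescaling by `ℓ`-th powers from `K_∞` -/

/-- **Rescaling into `‖p‖^δ ≤ ‖c t^ℓ‖ ≤ 1` by an `ℓ`-th power of an element of `K_∞`** (the value group of
`K_∞` is dense: `‖ζ_{p^m} - 1‖ = ‖p‖^{1/φ(p^m)}`). [cite: Tate1967, §3.1] -/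
theorem Kinf_exists_rescale {c : NormedAlgClosure F} (hc0 : c ≠ 0) {ℓ : ℕ} (hℓ : 0 < ℓ) {δ : ℝ}
    (hδ : 0 < δ) :
    ∃ t ∈ TateTrace.Kinf hp, t ≠ 0 ∧ ‖(p : NormedAlgClosure F)‖ ^ δ ≤ ‖c * t ^ ℓ‖ ∧ ‖c * t ^ ℓ‖ ≤ 1 := by
  have hprime : p.Prime := Fact.out
  have hp0 : (p : NormedAlgClosure F) ≠ 0 := Nat.cast_ne_zero.mpr hprime.ne_zero
  have hq0 : 0 < ‖(p : NormedAlgClosure F)‖ := norm_pos_iff.mpr hp0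
  have hq1 : ‖(p : NormedAlgClosure F)‖ < 1 := by
    rw [PadicBase.norm_natCast_closure hp]; exact PadicBase.norm_p_lt_one hp
  -- level `m = N + 1` with `φ(p^m) ≥ p^N > N ≥ ℓ/δ`
  set N : ℕ := ⌈(ℓ : ℝ) / δ⌉₊ with hN
  have hm : 1 ≤ N + 1 := Nat.le_add_left 1 N
  set π : NormedAlgClosure F := zeta F p (N + 1) - 1 with hπ
  have hπK : π ∈ TateTrace.Kinf hp :=
    sub_mem (TateTrace.K_le_Kinf hp (N + 1) (zeta_mem_K hp (N + 1))) (one_mem _)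
  have hπpos : 0 < ‖π‖ := norm_zeta_sub_one_pos (F := F) (p := p) hm
  have hπ0 : π ≠ 0 := norm_pos_iff.mp hπpos
  have hπ1 : ‖π‖ < 1 := by
    have h := norm_zeta_sub_one_pow (F := F) (p := p) hm
    by_contra hge
    rw [not_lt] at hge
    have : (1 : ℝ) ≤ ‖π‖ ^ (p ^ (N + 1)).totient := one_le_pow₀ hge
    rw [hπ, h] at this
    exact absurd hq1 (not_lt.mpr this)
  -- `‖π‖^ℓ ≥ ‖p‖^δ`
  have htot : ((p ^ (N + 1)).totient : ℝ) ≥ (ℓ : ℝ) / δ := by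
    rw [Nat.totient_prime_pow hprime (Nat.succ_pos N), Nat.succ_sub_one]
    have h1 : ((ℓ : ℝ) / δ) ≤ N := by rw [hN]; exact Nat.le_ceil _
    have h2 : (N : ℝ) < (p ^ N : ℕ) := by exact_mod_cast Nat.lt_pow_self hprime.one_lt
    have h3 : ((p ^ N : ℕ) : ℝ) ≤ ((p ^ N * (p - 1) : ℕ) : ℝ) := by
      exact_mod_cast Nat.le_mul_of_pos_right _ (Nat.sub_pos_of_lt hprime.one_lt)
    linarith
  have hπℓ : ‖(p : NormedAlgClosure F)‖ ^ δ ≤ ‖π‖ ^ ℓ := by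
    have htot0 : (0 : ℝ) < ((p ^ (N + 1)).totient : ℝ) := by
      have : (0:ℝ) < (ℓ : ℝ) / δ := div_pos (Nat.cast_pos.mpr hℓ) hδ
      linarith
    have hπeq : ‖π‖ = ‖(p : NormedAlgClosure F)‖ ^ (1 / ((p ^ (N + 1)).totient : ℝ)) := by
      rw [hπ, norm_zeta_sub_one hp hm, PadicBase.norm_natCast_closure hp]
    rw [hπeq, ← Real.rpow_natCast, ← Real.rpow_mul hq0.le]
    refine Real.rpow_le_rpow_of_exponent_ge hq0 hq1.le ?_
    rw [one_div, inv_mul_le_iff₀ htot0]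
    calc (ℓ : ℝ) = (ℓ / δ) * δ := by field_simp
      _ ≤ ((p ^ (N + 1)).totient : ℝ) * δ := mul_le_mul_of_nonneg_right htot hδ.le
  -- bracket `‖c‖` between powers of `y = (‖π‖^ℓ)⁻¹ > 1`
  have hr0 : 0 < ‖π‖ ^ ℓ := pow_pos hπpos ℓ
  have hr1 : ‖π‖ ^ ℓ < 1 := pow_lt_one₀ hπpos.le hπ1 hℓ.ne'
  set y : ℝ := (‖π‖ ^ ℓ)⁻¹ with hy
  have hy1 : 1 < y := by rw [hy]; exact one_lt_inv₀ hr0 |>.mpr hr1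
  have hy0 : 0 < y := zero_lt_one.trans hy1
  obtain ⟨n, hn1, hn2⟩ := exists_mem_Ioc_zpow (norm_pos_iff.mpr hc0) hy1
  refine ⟨π ^ (n + 1), zpow_mem hπK _, zpow_ne_zero _ hπ0, ?_, ?_⟩
  · -- `‖c π^{(n+1)ℓ}‖ = ‖c‖ y^{-(n+1)} > y⁻¹ = ‖π‖^ℓ ≥ ‖p‖^δ`
    have : ‖c * (π ^ (n + 1)) ^ ℓ‖ = ‖c‖ * (y ^ (n + 1))⁻¹ := by
      rw [norm_mul, ← zpow_natCast, ← zpow_mul, norm_zpow, mul_comm (n + 1) (ℓ : ℤ), zpow_mul,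
        zpow_natCast, hy, inv_zpow, inv_inv]
    rw [this]
    have hkey : y ^ n * (y ^ (n + 1))⁻¹ = ‖π‖ ^ ℓ := by
      rw [zpow_add_one₀ hy0.ne', mul_inv, ← mul_assoc, mul_inv_cancel₀ (zpow_ne_zero _ hy0.ne'),
        one_mul, hy, inv_inv]
    have h := mul_lt_mul_of_pos_right hn1 (inv_pos.mpr (zpow_pos hy0 (n + 1)))
    rw [hkey] at h
    exact hπℓ.trans h.le
  · have : ‖c * (π ^ (n + 1)) ^ ℓ‖ = ‖c‖ * (y ^ (n + 1))⁻¹ := by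
      rw [norm_mul, ← zpow_natCast, ← zpow_mul, norm_zpow, mul_comm (n + 1) (ℓ : ℤ), zpow_mul,
        zpow_natCast, hy, inv_zpow, inv_inv]
    rw [this]
    have h := mul_le_mul_of_nonneg_right hn2 (inv_pos.mpr (zpow_pos hy0 (n + 1))).le
    rwa [mul_inv_cancel₀ (zpow_ne_zero _ hy0.ne')] at h

variable (M : IntermediateField (PadicBase F p hp) (NormedAlgClosure F))

/-! ### §2 Adjoining `α` or `α t` (`t ∈ M^×`) gives the same field -/

/-- `M(α t) = M(α)` for `t ∈ M^×`. [folklore] -/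
private theorem adjoin_simple_mul_eq {α t : NormedAlgClosure F} (ht : t ∈ M) (ht0 : t ≠ 0) :
    (↥M)⟮α * t⟯ = (↥M)⟮α⟯ := by
  have htα : t ∈ (↥M)⟮α⟯ := ((↥M)⟮α⟯).algebraMap_mem ⟨t, ht⟩
  have htαt : t ∈ (↥M)⟮α * t⟯ := ((↥M)⟮α * t⟯).algebraMap_mem ⟨t, ht⟩
  apply le_antisymm
  · rw [adjoin_simple_le_iff]
    exact mul_mem (mem_adjoin_simple_self _ α) htα
  · rw [adjoin_simple_le_iff]
    have key : α * t * t⁻¹ ∈ (↥M)⟮α * t⟯ := mul_mem (mem_adjoin_simple_self _ (α * t)) (inv_mem htαt)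
    rwa [mul_assoc, mul_inv_cancel₀ ht0, mul_one] at key

/-! ### §3 The minimal polynomial of a radical generator -/

/-- If `α^ℓ = c` and `[M(α):M] ≥ ℓ` then `minpoly_M(α) = X^ℓ - c`. [folklore] -/
private theorem minpoly_eq_X_pow_sub_C {ℓ : ℕ} (hℓ : 0 < ℓ) {α : NormedAlgClosure F} {c : M}
    (hα : α ^ ℓ = (c : NormedAlgClosure F)) (hdeg : ℓ ≤ (minpoly M α).natDegree) :
    minpoly M α = X ^ ℓ - C c := by
  have hint : IsIntegral M α := ⟨X ^ ℓ - C c, monic_X_pow_sub_C c hℓ.ne', by simp [hα]⟩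
  have hdvd : minpoly M α ∣ X ^ ℓ - C c := minpoly.dvd M α (by simp [hα])
  refine (Polynomial.eq_of_monic_of_dvd_of_natDegree_le (minpoly.monic hint)
    (monic_X_pow_sub_C c hℓ.ne') hdvd ?_).symm
  rw [natDegree_X_pow_sub_C]; exact hdeg

/-! ### §4 The package of `M(c^{1/ℓ})` -/

set_option synthInstance.maxHeartbeats 200000 in
set_option maxHeartbeats 1600000 in
/-- **The almost-perfectoid package ascends along prime radical steps.** For `K_∞ ⊆ M` with the package
((Γ) and (U_s)), a prime `ℓ ≠ p`, and `α ∈ F̄` with `α^ℓ = c ∈ M^×`: the package of `M(α)` ((Γ) and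
(U_{min s 1 / 2})). [cite: Tate1967, §3.2] [cite: Scholze2012, Lemma 3.2] -/
theorem adjoin_primeRadical_package (hKM : TateTrace.Kinf hp ≤ M) {ℓ : ℕ} (hℓ : ℓ.Prime) (hℓp : ℓ ≠ p)
    {s : ℝ} (hs : 0 < s)
    (hΓ : ∀ x ∈ M, x ≠ 0 → ∃ c ∈ M, ‖c‖ ^ p = ‖x‖)
    (hU : ∀ u ∈ M, ‖u‖ ≤ 1 → ∃ w ∈ M, ‖u - w ^ p‖ ≤ ‖(p : NormedAlgClosure F)‖ ^ s)
    {α c : NormedAlgClosure F} (hcM : c ∈ M) (hc0 : c ≠ 0) (hα : α ^ ℓ = c) :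
    (∀ x ∈ (↥M)⟮α⟯, x ≠ 0 → ∃ c ∈ (↥M)⟮α⟯, ‖c‖ ^ p = ‖x‖) ∧
      (∀ u ∈ (↥M)⟮α⟯, ‖u‖ ≤ 1 → ∃ w ∈ (↥M)⟮α⟯,
        ‖u - w ^ p‖ ≤ ‖(p : NormedAlgClosure F)‖ ^ (min s 1 / 2)) := by
  classical
  have hprime : p.Prime := Fact.out
  have hp0 : (p : NormedAlgClosure F) ≠ 0 := Nat.cast_ne_zero.mpr hprime.ne_zero
  have hq0 : 0 < ‖(p : NormedAlgClosure F)‖ := norm_pos_iff.mpr hp0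
  have hq1 : ‖(p : NormedAlgClosure F)‖ < 1 := by
    rw [PadicBase.norm_natCast_closure hp]; exact PadicBase.norm_p_lt_one hp
  have hℓp' : ¬ p ∣ ℓ := fun h => hℓp ((Nat.prime_dvd_prime_iff_eq hprime hℓ).mp h).symm
  have hmin1 : 0 < min s 1 := lt_min hs one_pos
  have hhalf : ‖(p : NormedAlgClosure F)‖ ^ (min s 1) ≤ ‖(p : NormedAlgClosure F)‖ ^ (min s 1 / 2) :=
    Real.rpow_le_rpow_of_exponent_ge hq0 hq1.le (by linarith)
  have hα0 : α ≠ 0 := by intro h; rw [h, zero_pow hℓ.ne_zero] at hα; exact hc0 hα.symm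
  -- the generator as an integral element
  set cM : M := ⟨c, hcM⟩ with hcM'
  have hα' : α ^ ℓ = (cM : NormedAlgClosure F) := hα
  have hint : IsIntegral M α := ⟨X ^ ℓ - C cM, monic_X_pow_sub_C cM hℓ.ne_zero, by simp [hα']⟩
  set L : IntermediateField M (NormedAlgClosure F) := (↥M)⟮α⟯ with hL
  haveI : FiniteDimensional M L := adjoin.finiteDimensional hint
  haveI : Module.Free M L := Module.Free.of_divisionRing M L
  have hfin : finrank M L = (minpoly M α).natDegree := adjoin.finrank hint
  have hdegle : (minpoly M α).natDegree ≤ ℓ := by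
    have h := natDegree_le_of_dvd (minpoly.dvd M α (by simp [hα'] : aeval α (X ^ ℓ - C cM) = 0))
      (monic_X_pow_sub_C cM hℓ.ne_zero).ne_zero
    rwa [natDegree_X_pow_sub_C] at h
  rcases hdegle.lt_or_eq with hlt | heq
  · -- Case `[M(α):M] < ℓ`: `c ∈ M^ℓ`, `M(α) = M(ζ)` with `ζ^ℓ = 1`
    set n : ℕ := (minpoly M α).natDegree with hn
    have hn0 : 0 < n := by rw [← hfin]; exact finrank_pos
    set g : L := AdjoinSimple.gen M α with hg
    have hgℓ : g ^ ℓ = algebraMap M L cM := by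
      apply Subtype.ext; rw [hg]; push_cast; exact hα'
    set Nα : M := Algebra.norm M g with hNα
    have hNℓ : Nα ^ ℓ = cM ^ n := by
      rw [hNα, ← map_pow, hgℓ, Algebra.norm_algebraMap, hfin]
    have hcM0 : cM ≠ 0 := fun h => hc0 (by rw [hcM'] at h; exact congrArg Subtype.val h)
    have hNα0 : Nα ≠ 0 := by
      intro h; rw [h, zero_pow hℓ.ne_zero] at hNℓ; exact pow_ne_zero n hcM0 hNℓ.symm
    -- Bezout `n a = ℓ b + 1`
    have hcop : Nat.Coprime n ℓ :=
      Nat.coprime_comm.mp ((Nat.Prime.coprime_iff_not_dvd hℓ).mpr fun h => not_le.mpr hlt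
        (Nat.le_of_dvd hn0 h))
    obtain ⟨a, -, ha⟩ := Nat.exists_mul_mod_eq_one_of_coprime hcop hℓ.one_lt
    set b : ℕ := n * a / ℓ with hb
    have hna : n * a = ℓ * b + 1 := by rw [hb, ← ha, Nat.div_add_mod]
    -- `c = m₂^ℓ` with `m₂ = Nα^a / c^b`
    set m₂ : M := Nα ^ a * (cM ^ b)⁻¹ with hm₂
    have hm₂ℓ : m₂ ^ ℓ = cM := by
      have h1 : (Nα ^ a) ^ ℓ = cM * (cM ^ b) ^ ℓ := by
        rw [← pow_mul, mul_comm a ℓ, pow_mul, hNℓ, ← pow_mul, hna]; ring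
      rw [hm₂, mul_pow, inv_pow, h1, mul_assoc, mul_inv_cancel₀ (pow_ne_zero _ (pow_ne_zero _ hcM0)),
        mul_one]
    have hm₂0 : m₂ ≠ 0 := by intro h; rw [h, zero_pow hℓ.ne_zero] at hm₂ℓ; exact hcM0 hm₂ℓ.symm
    have hm₂E0 : (m₂ : NormedAlgClosure F) ≠ 0 := fun h => hm₂0 (Subtype.ext h)
    set ζ : NormedAlgClosure F := α * (m₂ : NormedAlgClosure F)⁻¹ with hζ
    have hζℓ : ζ ^ ℓ = 1 := by
      rw [hζ, mul_pow, hα', ← hm₂ℓ, inv_pow]; push_cast; exact mul_inv_cancel₀ (pow_ne_zero _ hm₂E0)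
    have hLeq : (↥M)⟮α⟯ = (↥M)⟮ζ⟯ := by
      rw [hζ]; exact (adjoin_simple_mul_eq hp M (inv_mem m₂.2) (inv_ne_zero hm₂E0)).symm
    obtain ⟨hΓζ, hUζ⟩ := adjoin_rootOfUnity_package hp M hℓp' hℓ.ne_zero hζℓ hs hΓ hU
    rw [← hLeq] at hΓζ hUζ
    exact ⟨hΓζ, fun u hu hu1 => by
      obtain ⟨w, hw, h⟩ := hUζ u hu hu1; exact ⟨w, hw, h.trans hhalf⟩⟩
  · -- Case `[M(α):M] = ℓ`: rescale and use the different `ℓ α^{ℓ-1}`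
    have hnd : ¬ p ∣ finrank M L := by rw [hfin, heq]; exact hℓp'
    refine ⟨fun x hx hx0 => exists_norm_pow_eq_of_not_dvd_finrank hp M L hnd hΓ hx hx0, ?_⟩
    intro u hu hu1
    set δ : ℝ := min s 1 / (2 * p) with hδ
    have hpR : (0 : ℝ) < p := Nat.cast_pos.mpr hprime.pos
    have hδ0 : 0 < δ := by rw [hδ]; exact div_pos hmin1 (by positivity)
    obtain ⟨t, htK, ht0, htδ, ht1⟩ := Kinf_exists_rescale hp hc0 hℓ.pos hδ0
    have htM : t ∈ M := hKM htK
    set α' : NormedAlgClosure F := α * t with hα't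
    set c'M : M := ⟨c * t ^ ℓ, mul_mem hcM (pow_mem htM ℓ)⟩ with hc'M
    have hα'' : α' ^ ℓ = (c'M : NormedAlgClosure F) := by rw [hα't, mul_pow, hα]
    have hLeq : (↥M)⟮α'⟯ = (↥M)⟮α⟯ := adjoin_simple_mul_eq hp M htM ht0
    have hint' : IsIntegral M α' := ⟨X ^ ℓ - C c'M, monic_X_pow_sub_C c'M hℓ.ne_zero, by simp [hα'']⟩
    have hdeg' : ℓ ≤ (minpoly M α').natDegree := by
      rw [← adjoin.finrank hint', hLeq, hfin, heq]
    have hmin' : minpoly M α' = X ^ ℓ - C c'M := minpoly_eq_X_pow_sub_C hp M hℓ.pos hα'' hdeg'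
    have hu' : u ∈ (↥M)⟮α'⟯ := by rw [hLeq]; exact hu
    obtain ⟨w, hw, h⟩ := radical_exists_norm_sub_pow_le hp M hℓ hℓp hs hΓ hU hα'' hmin' htδ ht1 hu' hu1
    refine ⟨w, by rw [hL, ← hLeq]; exact hw, h.trans (le_of_eq ?_)⟩
    congr 1
    rw [hδ]; field_simp; ring

end TateAlmostEtale

end Literature.NumberTheory.PAdicHodge

end
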